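import Summits.BirchSwinnertonDyer.BirchSwinnertonDyer.Theorems.ErratumRoadFiveIrrKNoFixedTorsion
import Literature.NumberTheory.EllipticCurves.OrdinaryNewformDatumSelfDualTwist
import HarnessLib

/-!
# (irr_K) for the SELF-DUAL module: `A_g^† = A_g ⊗ ε^{1−k/2}` has no non-zero `Γ_K`-fixed element when `ρ̄_g` is irreducible,
# `p` is odd and `K/ℚ` is quadratic — the (glob) input of the two-variable control theorem for the erratum's own `A_g`

Cell `bsd-stepL`, seat `bsd-stepL-imc-p1` g24 — TWIST AUDIT of crux `ErratumThm23SigmaLe` (item stmt-BirchSwinnertonDyer-25505), first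
brick of the LINE of the re-keyed crux (`erratum_chain`†; memo `HOME/imc-p1/g24/TWIST-AUDIT-25505-imc-p1-g24.md` §7): the hypothesis
(glob) of `ControlAt.exists_controlMap` ∕ `ControlFiniteDefect.exists_controlMap_of_finite_defect` for the self-dual module
`Δ.selfDualCofreeRepOver K`. `--supports stmt-BirchSwinnertonDyer-25505 --as helper`. Theorems only (0 def ∕ 0 fact ∕ 0 sorry).

## The argument (twin of `IrrK.noFixedTorsion_of_isResiduallyIrreducible`, g21)

Reduce to the `ϖ`-torsion (`TorsionControl.forall_invariant_eq_zero_of_torsionBy`; `A_g^†` is `ϖ`-primary). A `ϖ`-torsion class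
`x mod 𝒪²` (`y = ϖx ∈ 𝒪²`) fixed by `Γ_K` under `T_g^† = T_g ⊗ ε^{1−k/2}` gives `T_g^†(σ) y ≡ y (mod ϖ)` for `σ ∈ Γ_K`, i.e. the
reduction `ȳ` is fixed by `Γ_K` under the TWISTED residual representation `ρ̄' := ε̄^{1−k/2} · ρ̄_g` (`ρ̄_g = SkinnerUrban2014.residualRep Δ`).
Since `ε̄^{1−k/2}` is a character of `Γ_ℚ`, `ρ̄'` is again a representation of `Γ_ℚ` on `k²`, with the SAME subrepresentations as `ρ̄_g`
(scalars preserve submodules), hence irreducible; so `ȳ = 0` by the index-two lemma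
(`eq_zero_of_forall_apply_eq_of_index_two`, `[Γ_ℚ : Γ_K] = 2`, `2 ∈ kˣ`), `y ∈ ϖ𝒪²`, `x ∈ 𝒪²`, and the class is `0`. No
hypothesis on `k` is needed. (A `Γ_K`-eigenvector of `ρ̄_g` for a character that does NOT extend to `Γ_ℚ` could exist — dihedral `ρ̄_g` — but
`ε̄^{k/2−1}` does extend.)

* `noFixedTorsion_selfDual_of_isResiduallyIrreducible` — (glob)† for `Δ.selfDualCofreeRepOver K`;
* `noFixedTorsion_selfDual_of_isResiduallyIrreducible'` — the same with the line's binder list (`3 < p`, `IsImaginaryQuadratic K`) and the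
  (automatic) `p`-power-torsion clause, in the shape of the stub (glob) of line `erratum_chain`.

[cite: Castella2018Erratum, §2 (p. 2: the self-dual Tate twist `A_g`) and Lemma 2.1, proof (p. 2: "H⁰(K, M_g) = 0 … irreducibility of ρ̄_g|_{G_K}")]
[cite: JetchevSkinnerWan2017, §3.1 (irr_K)]
-/

noncomputable section

open scoped MatrixGroups

-- D-0017: single-problem summit, the namespace repeats the problem name by design.
set_option linter.dupNamespace false
set_option autoImplicit false

namespace Summit.BirchSwinnertonDyer.BirchSwinnertonDyer.Theorems.SelfDualTwist

open Literature.NumberTheory.GaloisRepresentations Literature.NumberTheory.EllipticCurves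
  Literature.NumberTheory.EllipticCurves.GreenbergSelmer Literature.NumberTheory.EllipticCurves.ModularForms
  Field
open Summit.BirchSwinnertonDyer.BirchSwinnertonDyer.Theorems.ErratumThm23TwoVariable.IrrK

variable {M : ℕ} {k : ℤ} {g : CuspForm (CongruenceSubgroup.Gamma0 M) k} {p : ℕ} [Fact p.Prime]
  {ι : coeffField g →+* PadicAlgCl p} (Δ : OrdinaryNewformDatum g p ι)
  (K : Type) [Field K] [NumberField K]

/-- **A representation that is pointwise a unit multiple of an irreducible one is irreducible**: if `π g v = c(g) • ρ g v` with
`c(g) ∈ kˣ`, then `ρ` and `π` have the same subrepresentations (scalars preserve submodules), so `IsSimpleOrder` transfers along the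
resulting order isomorphism. Used for the twisted residual representation `ε̄^{1−k/2} ρ̄_g`. [folklore]
[cite: Castella2018Erratum, §2 (p. 2, the self-dual Tate twist)] -/
theorem isSimpleOrder_subrepresentation_of_eq_units_smul {R G V : Type*} [CommRing R] [Monoid G] [AddCommGroup V]
    [Module R V] (ρ π : Representation R G V) (c : G → Rˣ) (h : ∀ (g : G) (v : V), π g v = ((c g : Rˣ) : R) • ρ g v)
    [IsSimpleOrder (Subrepresentation ρ)] : IsSimpleOrder (Subrepresentation π) := by
  let e : Subrepresentation ρ ≃o Subrepresentation π :=
    { toFun := fun S ↦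
        { toSubmodule := S.toSubmodule
          apply_mem_toSubmodule := fun g v hv ↦ by
            rw [h]
            exact S.toSubmodule.smul_mem _ (S.apply_mem_toSubmodule g hv) }
      invFun := fun S ↦
        { toSubmodule := S.toSubmodule
          apply_mem_toSubmodule := fun g v hv ↦ by
            have h' := S.toSubmodule.smul_mem (((c g)⁻¹ : Rˣ) : R) (S.apply_mem_toSubmodule g hv)
            rwa [h, smul_smul, Units.inv_mul, one_smul] at h' }
      left_inv := fun _ ↦ Subrepresentation.toSubmodule_injective rfl
      right_inv := fun _ ↦ Subrepresentation.toSubmodule_injective rfl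
      map_rel_iff' := Iff.rfl }
  exact e.isSimpleOrder_iff.1 inferInstance

set_option maxHeartbeats 800000 in
-- the matrix coercions of the framed Galois representation at `Γ_K`-elements are costly to elaborate
/-- **(glob)† from (irred).** If `ρ̄_g = residualRep Δ` is irreducible over `Γ_ℚ`, `p ≠ 2` and `K/ℚ` is quadratic, then the SELF-DUAL
module `A_g^† = Cofree Δ.selfDualRep` has no non-zero `Γ_K`-fixed element: a fixed `ϖ`-torsion class reduces to a vector fixed by `Γ_K`
under the twisted residual representation `ε̄^{1−k/2} ρ̄_g`, which is irreducible (same subrepresentations as `ρ̄_g`), so the index-two lemma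
kills it. Twin of `IrrK.noFixedTorsion_of_isResiduallyIrreducible`.
[cite: Castella2018Erratum, §2 (p. 2) and Lemma 2.1, proof (p. 2)] [cite: JetchevSkinnerWan2017, §3.1 (irr_K)] -/
theorem noFixedTorsion_selfDual_of_isResiduallyIrreducible (hp : p ≠ 2) (hK : Module.finrank ℚ K = 2)
    (hirr : SkinnerUrban2014.IsResiduallyIrreducible Δ) :
    ∀ a : Cofree Δ.selfDualRep (padicCoeffField ι),
      (∀ σ : absoluteGaloisGroup K, (Δ.selfDualCofreeRepOver K) σ a = a) → a = 0 := by
  classical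
  haveI : IsSimpleOrder (Subrepresentation (SkinnerUrban2014.residualRep Δ)) := hirr
  haveI := nontrivial_residue Δ
  have hidx := (Literature.NumberTheory.Automorphic.isOpen_range_absGaloisRestrict_and_index_eq_two ℚ K hK).2
  have hinj : Function.Injective (algebraMap (padicCoeffIntegers ι) (padicCoeffField ι)) :=
    Subtype.val_injective
  -- the twisted residual representation `ρ̄' = T_g^† mod ϖ` (base change of the twisted frame, as `residualRep` is of `Δ.ρ`)
  set mk := Ideal.Quotient.mk (Ideal.span {Δ.ϖ}) with hmk
  let π' : Representation (padicCoeffIntegers ι ⧸ Ideal.span {Δ.ϖ}) (absoluteGaloisGroup ℚ)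
      (Fin 2 → padicCoeffIntegers ι ⧸ Ideal.span {Δ.ϖ}) :=
    FramedRep.baseChangeRepresentation mk Δ.selfDualRep
  have hπ'mat : ∀ (σ : absoluteGaloisGroup ℚ) (v : Fin 2 → padicCoeffIntegers ι ⧸ Ideal.span {Δ.ϖ}),
      π' σ v = (((Δ.selfDualRep σ : GL (Fin 2) (padicCoeffIntegers ι)) :
        Matrix (Fin 2) (Fin 2) (padicCoeffIntegers ι)).map mk).mulVec v := fun σ v ↦ by
    simp only [π', FramedRep.baseChangeRepresentation_apply_apply]
    rfl
  -- `ρ̄'(σ) = ε̄^{1−k/2}(σ) · ρ̄_g(σ)` on vectors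
  have hπ' : ∀ (σ : absoluteGaloisGroup ℚ) (v : Fin 2 → padicCoeffIntegers ι ⧸ Ideal.span {Δ.ϖ}),
      π' σ v = mk ((selfDualTwistChar ι σ : (padicCoeffIntegers ι)ˣ) : padicCoeffIntegers ι) •
        SkinnerUrban2014.residualRep Δ σ v := fun σ v ↦ by
    rw [hπ'mat, residualRep_apply_eq, OrdinaryNewformDatum.coe_selfDualRep_apply]
    ext i
    simp only [Matrix.mulVec, dotProduct, Matrix.map_apply, Matrix.smul_apply, smul_eq_mul, map_mul, Pi.smul_apply,
      Finset.mul_sum, mul_assoc]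
    rfl
  -- `ρ̄'` has the same subrepresentations as `ρ̄_g` (the scalar `ε̄^{1−k/2}(σ)` is a unit), hence is irreducible
  haveI : IsSimpleOrder (Subrepresentation π') :=
    isSimpleOrder_subrepresentation_of_eq_units_smul (SkinnerUrban2014.residualRep Δ) π'
      (fun σ ↦ Units.map (mk : padicCoeffIntegers ι →* padicCoeffIntegers ι ⧸ Ideal.span {Δ.ϖ}) (selfDualTwistChar ι σ))
      (fun σ v ↦ hπ' σ v)
  -- reduce to the `ϖ`-torsion
  refine Summit.BirchSwinnertonDyer.Rank1Residual.X11b.TorsionControl.forall_invariant_eq_zero_of_torsionBy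
    (Δ.selfDualCofreeRepOver K) Δ.ϖ
    (Cofree.exists_pow_varpi_smul_eq_zero Δ Δ.selfDualRep) fun a hϖa hfix ↦ ?_
  obtain ⟨x, rfl⟩ := cofreeMk_surjective (padicCoeffField ι) Δ.selfDualRep a
  -- `y = ϖ x ∈ 𝒪²`
  have hy : Δ.ϖ • x ∈ lattice 2 (padicCoeffIntegers ι) (padicCoeffField ι) := by
    rw [← ker_cofreeMk (padicCoeffField ι) Δ.selfDualRep, LinearMap.mem_ker, map_smul]
    exact hϖa
  obtain ⟨y, hyx⟩ := (mem_lattice_iff _).1 hy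
  -- the reduction `v` of `y` is fixed by `Γ_K` under the TWISTED residual representation `ρ̄'`
  have hfixv : ∀ σ : absoluteGaloisGroup K,
      π' ((absGaloisRestrict ℚ K : absoluteGaloisGroup K →* absoluteGaloisGroup ℚ) σ)
          (fun i ↦ mk (y i)) = fun i ↦ mk (y i) := by
    intro σ
    -- `T^†(σ) x - x ∈ 𝒪²`
    have hσ := hfix σ
    rw [ContinuousRep.restrict_apply, OrdinaryNewformDatum.selfDualCofreeRep_apply, smul_cofreeMk, ← sub_eq_zero,
      ← map_sub, ← LinearMap.mem_ker, ker_cofreeMk (padicCoeffField ι) Δ.selfDualRep, mem_lattice_iff,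
      fracRepresentation_apply_apply] at hσ
    obtain ⟨z, hz⟩ := hσ
    -- `T^†(σ) y - y = ϖ z` in `𝒪²`, hence `(T^†(σ) mod ϖ) ȳ = ȳ`
    have key := mulVec_sub_eq_smul_of_smul_eq hinj
      (((Δ.selfDualRep (absGaloisRestrict ℚ K σ) : GL (Fin 2) (padicCoeffIntegers ι)) :
        Matrix (Fin 2) (Fin 2) (padicCoeffIntegers ι))) Δ.ϖ x y z hyx hz
    have hred := map_mulVec_eq_of_mulVec_sub_eq_smul
      (((Δ.selfDualRep (absGaloisRestrict ℚ K σ) : GL (Fin 2) (padicCoeffIntegers ι)) :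
        Matrix (Fin 2) (Fin 2) (padicCoeffIntegers ι))) Δ.ϖ y z key
    have hφσ : (absGaloisRestrict ℚ K : absoluteGaloisGroup K →* absoluteGaloisGroup ℚ) σ =
        absGaloisRestrict ℚ K σ := rfl
    rw [hφσ, hπ'mat]
    exact hred
  -- the reduction vanishes
  have hv0 : (fun i ↦ mk (y i)) = 0 :=
    eq_zero_of_forall_apply_eq_of_index_two (isUnit_two_residue Δ hp) π'
      (absGaloisRestrict ℚ K : absoluteGaloisGroup K →* absoluteGaloisGroup ℚ) hidx _ hfixv
  -- hence `y ∈ ϖ 𝒪²`, `x ∈ 𝒪²`, `a = 0`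
  have hyϖ : ∀ i, ∃ w : padicCoeffIntegers ι, y i = Δ.ϖ * w := fun i ↦ by
    have := congrFun hv0 i
    rw [Pi.zero_apply, hmk, Ideal.Quotient.eq_zero_iff_mem, Ideal.mem_span_singleton'] at this
    obtain ⟨w, hw⟩ := this
    exact ⟨w, by rw [← hw, mul_comm]⟩
  choose w hw using hyϖ
  have hx : x ∈ lattice 2 (padicCoeffIntegers ι) (padicCoeffField ι) := by
    rw [mem_lattice_iff]
    refine ⟨w, funext fun i ↦ ?_⟩
    have hyi := congrFun hyx i
    rw [Pi.smul_apply, Algebra.smul_def, hw i, map_mul] at hyi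
    exact (mul_left_cancel₀ (algebraMap_varpi_ne_zero Δ) hyi.symm).symm
  rw [← ker_cofreeMk (padicCoeffField ι) Δ.selfDualRep, LinearMap.mem_ker] at hx
  exact hx

/-- **(glob)† with the line's binder list** (`3 < p`, `K` imaginary quadratic, `ρ̄_g` irreducible): no non-zero `Γ_K`-fixed
`p`-power-torsion element of `A_g^†` — the shape of the stub (glob) of line `erratum_chain` (v3 `stub_irrK_noFixedTorsion`), for the
self-dual module. [cite: Castella2018Erratum, §2 (p. 2) and Lemma 2.1, proof (p. 2)] [cite: JetchevSkinnerWan2017, §3.1 (irr_K)] -/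
theorem noFixedTorsion_selfDual_of_isResiduallyIrreducible' (hp : 3 < p) (hK : IsImaginaryQuadratic K)
    (hirr : SkinnerUrban2014.IsResiduallyIrreducible Δ) :
    ∀ a : Cofree Δ.selfDualRep (padicCoeffField ι),
      (∀ σ : absoluteGaloisGroup K, (Δ.selfDualCofreeRepOver K) σ a = a) → (∃ j : ℕ, p ^ j • a = 0) → a = 0 :=
  fun a ha _ ↦ noFixedTorsion_selfDual_of_isResiduallyIrreducible Δ K (by omega) hK.1 hirr a ha

end Summit.BirchSwinnertonDyer.BirchSwinnertonDyer.Theorems.SelfDualTwist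

end
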